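import Summits.QuantumFields.YangMills.Theorems.BalabanUVNodesN06Thm312313ParLawsQL2

/-!
# BalabanUVNodes ∕ N06 ([B9], `Dag.B9_main`) — CASCADE-K: KD's DISPLAYED BLOCK-L² LAWS `hqsL2K` ∕ `hqL2K` AT THE KNIT PAIR OF RECORD (PART 4, sequel of
# `…N06Thm312313ParLawsQL2`): the binders of dag-n06-d's `…N06AtOpsYSectEStKnitSectDKD.t312_t313_opsYSectESt_knit_KD` VERBATIM, from the regime bridge and x-free numerics

Track A of `YM-PLAN.md` (cell `pub-ymgap`, HUMAN RULING D-0062), node **N06** = [Balaban1985BackgroundPropagators] Thms 3.1–3.15; rows 20–21, seat `pub-ymgap-dag-n06-l`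
(g39).  WHY.  The parent file proves the block-L² letters of the knit pair on the member's local class (3.35): `blockBd_QscoKHq_adjTrY_QknitY_of_reg335P` (`Q⋆`) and
`blockBd_QcoKHq_QknitY_of_reg335P` (`Q`, by adjointness), length-ratio forms above the [4] (2.60) threshold.  THIS FILE packages them as KD's two displayed binders (referee
ref-A's «OPEN 2∕14» of KD, bus I.20680), exactly as parts 2–3 packaged `hqK ∕ hqsK`: at any Sect.-D record `𝔬12` whose `Qstar ∕ Q` are pinned to def-Y's models at
`(qsKnitOfRecord, qKnitOfRecord)` (`hQsco12 ∕ hQco12`) with block maps `blkBK (bI x) ∕ blkHK` (`hblk12 ∕ hblkZ12`), from the regime bridge `hRP` (the certificate's `hRP1`: the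
carrier's class at `c` refines the member's local class `(bg9KP … SU(N) …).Reg335 c₀`, `c₀ ≤ 10`), the x-free knit numerics `0 < α₀′ ≤ α_Q`, `hKpl : 0 ≤ a ≤ a12 ⇒ K_pl(a)·L⁴ < α₀′`,
`0 < M12`, and ONE (2.60) numeric at the floor `hM12L : log L ≤ ε(2L²−1)M12` (any `ε > 0`), at EVERY rate `δQs ≥ 0`, common constant
`BQL := N⁴(1 + 2(d+1)K_col α₀′)·L·e^{(δQs+ε)(ℓ+4)}` (`BQL_knit_nonneg` = KD's `hBQL`): ★★★ `hqsL2K_knit_of_laws`, ★★★ `hqL2K_knit_of_laws`.  KD's `hδQs1 hδQs2 hδQs3` floors on `δQs` are the consumer's choice of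
rate (free here).
HONEST FRAMING.  Packaging of the parent's kernel-checked letters; regime bridge and numerics are HYPOTHESES; COUNT-NEUTRAL; nothing of [B9]'s propagator estimates asserted;
N06 NOT discharged; K1⁹ NOT closed; one finite 𝕋⁴ programme at fixed `ε` — NOT continuum, NOT OS, NOT the mass gap ∕ Clay.  0 `def`, 0 `sorry`.
[cite: Balaban1985BackgroundPropagators, Thm 3.13 p.426 (the letters Q, Q\*), (3.46) p.398, (3.13) p.393, (3.115) p.418, (3.35) p.396; Balaban1985Averaging, Prop. 2 p.26, (139)–(147) pp.39–40;
Balaban1984PropagatorsII, Lemma 2.1 (2.60) p.234]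
-/

noncomputable section

namespace Summit.QuantumFields.YangMills.BalabanUVNodes.N06Thm312313ParLawsQL2Knit

open scoped Matrix Matrix.Norms.L2Operator
open Literature.MathematicalPhysics.QuantumFieldTheory.Balaban1983to89
open Literature.MathematicalPhysics.QuantumFieldTheory.Balaban1983to89.Node00
open Literature.MathematicalPhysics.QuantumFieldTheory.Balaban1983to89.B6KLevelCensusIndexV1 (kGeo)
open Literature.MathematicalPhysics.QuantumFieldTheory.Balaban1983to89.B9PinMembersKLevelV1 (MemberY geo9Y)
open Literature.MathematicalPhysics.QuantumFieldTheory.Balaban1983to89.B9BackgroundsKLevelV1R (RegFamY bg9YR)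
open Literature.MathematicalPhysics.QuantumFieldTheory.Balaban1983to89.B7Prop2SpecialUnitary (specialUnitaryUnits specialUnitaryUnits_le_unitaryUnits)
open Literature.MathematicalPhysics.QuantumFieldTheory.Balaban1983to89.B9CoReadingCoordsTranspose (TrIdx trBasis)
open Literature.MathematicalPhysics.QuantumFieldTheory.Balaban1983to89.B9CoReadingCoords (XBK blkBK)
open Literature.MathematicalPhysics.QuantumFieldTheory.Balaban1983to89.B9CoReadingCoordsH (XHK blkHK)
open Literature.MathematicalPhysics.QuantumFieldTheory.Balaban1983to89.B9Thm312Whole (Ops)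
open Literature.MathematicalPhysics.QuantumFieldTheory.Balaban1983to89.Node00.OpsYQLetter (qKnitOfRecord qsKnitOfRecord adjTrY)
open Literature.MathematicalPhysics.QuantumFieldTheory.Balaban1983to89.Node00.OpsYOps312OfRecordPar (QscoKHq QcoKHq)
open Literature.MathematicalPhysics.QuantumFieldTheory.Balaban1983to89.B6Geom246MultiLevelTorus (geomT)
open Literature.MathematicalPhysics.QuantumFieldTheory.Balaban1983to89.B6GlobalChartV1 (blkV1)
open Literature.MathematicalPhysics.QuantumFieldTheory.Balaban1983to89.B6Ineq2142KLevelV1 (lvl β)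
open Literature.MathematicalPhysics.QuantumFieldTheory.Balaban1983to89.B9GeoNormsKLevelV1 (geo9K)
open Literature.MathematicalPhysics.QuantumFieldTheory.Balaban1983to89.B9Thm34Ext (toB6)
open Literature.MathematicalPhysics.QuantumFieldTheory.Balaban1983to89.B9SectDL2Decay (BlockBd)
open Literature.MathematicalPhysics.QuantumFieldTheory.Balaban1983to89.B9Eq316AveragingTransposeZd (alphaQ)
open Literature.MathematicalPhysics.QuantumFieldTheory.Balaban1983to89.B9Eq3115KnitLetterY (QknitY)
open Literature.MathematicalPhysics.QuantumFieldTheory.Balaban1983to89.B9Eq3115KnitLetterYOnto (kCol)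
open Literature.MathematicalPhysics.QuantumFieldTheory.Balaban1983to89.B9C2FormBoxRegimeY (Kpl)
open Literature.MathematicalPhysics.QuantumFieldTheory.Balaban1983to89.B9BackgroundsKLevelV1P (bg9KP)
open Summit.QuantumFields.YangMills.BalabanUVNodes.N06Thm312313ParLawsQL2 (blockBd_QscoKHq_adjTrY_QknitY_of_reg335P blockBd_QcoKHq_QknitY_of_reg335P)

/-! ## KD's binders `hqsL2K` ∕ `hqL2K` at the knit pair of record -/

section KnitBinder

open scoped Matrix

variable {N : ℕ} [Nonempty (Fin N)] (θ : Stage3Params) (Mstar : ℕ) {R₁ R₂ : RegFamY θ.d₆ θ.ℓ₆ θ.hd' θ.hL' θ.b₀ θ.b₁ Mstar (Matrix (Fin N) (Fin N) ℂ)} {c : ℝ}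
variable [∀ x : MemberY θ.d₆ θ.ℓ₆ θ.hd' θ.hL' θ.b₀ θ.b₁ Mstar, Fintype (geo9Y x).Site]

omit [Nonempty (Fin N)] [∀ x : MemberY θ.d₆ θ.ℓ₆ θ.hd' θ.hL' θ.b₀ θ.b₁ Mstar, Fintype (geo9Y x).Site] in
/-- (2.60) at the floor serves above the floor. [cite: Balaban1984PropagatorsII, Lemma 2.1 (2.60) p.234, bookkeeping] -/
private theorem transfer_of_floor {M12 ε : ℝ} (hε : 0 < ε)
    (hM12L : Real.log (((θ.ℓ₆ + 1 : ℕ) : ℝ)) ≤ ε * (2 * ((θ.ℓ₆ : ℝ) + 1) ^ 2 - 1) * M12)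
    (x : MemberY θ.d₆ θ.ℓ₆ θ.hd' θ.hL' θ.b₀ θ.b₁ Mstar) (hM : M12 ≤ (geo9Y x).M) :
    Real.log (geo9K x.toKIdx).L ≤ ε * (2 * ((θ.ℓ₆ : ℝ) + 1) ^ 2 - 1) * (geo9K x.toKIdx).M :=
  calc Real.log (geo9K x.toKIdx).L = Real.log (((θ.ℓ₆ + 1 : ℕ) : ℝ)) := rfl
    _ ≤ ε * (2 * ((θ.ℓ₆ : ℝ) + 1) ^ 2 - 1) * M12 := hM12L
    _ ≤ ε * (2 * ((θ.ℓ₆ : ℝ) + 1) ^ 2 - 1) * (geo9Y x).M :=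
        mul_le_mul_of_nonneg_left hM (mul_nonneg hε.le (by nlinarith [sq_nonneg (θ.ℓ₆ : ℝ), Nat.cast_nonneg (α := ℝ) θ.ℓ₆]))

omit [Nonempty (Fin N)] [∀ x : MemberY θ.d₆ θ.ℓ₆ θ.hd' θ.hL' θ.b₀ θ.b₁ Mstar, Fintype (geo9Y x).Site] in
/-- the common constant `BQL := N⁴(1 + 2(d+1)K_col α₀′)·L·e^{(δQs+ε)(ℓ+4)}` of the two laws is `≥ 0` (KD's `hBQL`), for `α₀′ ≥ 0`.
[cite: Balaban1985BackgroundPropagators, Thm 3.13 p.426, bookkeeping] -/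
theorem BQL_knit_nonneg {α₀' δQs ε : ℝ} (hα : 0 ≤ α₀') :
    0 ≤ (N : ℝ) ^ 4 * (1 + kCol (θ.d₆ + 1) (θ.ℓ₆ + 1) * α₀' * (2 * ((θ.d₆ : ℝ) + 1))) * (((θ.ℓ₆ + 1 : ℕ) : ℝ)) * Real.exp ((δQs + ε) * ((θ.ℓ₆ : ℝ) + 4)) := by
  have := B9Eq3115KnitLetterYOnto.kCol_nonneg (θ.d₆ + 1) (θ.ℓ₆ + 1)
  positivity

/-- ★★★ **KD's BINDER `hqsL2K` AT THE KNIT PAIR, FROM THE DISPLAYED REGIME BRIDGE AND X-FREE NUMERICS**: at any Sect.-D record `𝔬12` whose `Qstar` is pinned to def-Y's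
`QscoKHq … (qsKnitOfRecord N θ x.toKIdx)` (`hQsco12`) with block maps `blkBK (bI x) ∕ blkHK` (`hblk12 ∕ hblkZ12`), over the class-parametric carrier: the regime bridge `hRP` (the
certificate's `hRP1`), the x-free knit numerics `0 < α₀′ ≤ α_Q`, `hKpl : 0 ≤ a ≤ a12 ⇒ K_pl(a)·L⁴ < α₀′`, `0 < M12` and the (2.60) numeric `hM12L : log L ≤ ε(2L²−1)M12` give
`t312_t313_opsYSectESt_knit_KD`'s `hqsL2K` VERBATIM at every rate `δQs ≥ 0` with `BQL := N⁴(1 + 2(d+1)K_col α₀′)·L·e^{(δQs+ε)(ℓ+4)}`.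
[cite: Balaban1985BackgroundPropagators, Thm 3.13 p.426 (the letter Q\*), (3.46) p.398, (3.13) p.393, (3.115) p.418, (3.35) p.396; Balaban1985Averaging, Prop. 2 p.26; Balaban1984PropagatorsII, Lemma 2.1 (2.60) p.234] -/
theorem hqsL2K_knit_of_laws
    {W12 : MemberY θ.d₆ θ.ℓ₆ θ.hd' θ.hL' θ.b₀ θ.b₁ Mstar → Type} [∀ x, Fintype (W12 x)]
    (𝔬12 : ∀ x : MemberY θ.d₆ θ.ℓ₆ θ.hd' θ.hL' θ.b₀ θ.b₁ Mstar, Ops (geo9Y x) (bg9YR (Matrix (Fin N) (Fin N) ℂ) (specialUnitaryUnits (Fin N)) R₁ R₂ x) (XBK (TrIdx N) x.toKIdx) (XBK (TrIdx N) x.toKIdx) (XHK (TrIdx N) x.toKIdx) (W12 x))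
    (bI : ∀ x : MemberY θ.d₆ θ.ℓ₆ θ.hd' θ.hL' θ.b₀ θ.b₁ Mstar, FBondY x.toKIdx → IBondY x.toKIdx)
    (hβ1 : ∀ (x : MemberY θ.d₆ θ.ℓ₆ θ.hd' θ.hL' θ.b₀ θ.b₁ Mstar) (f : FBondY x.toKIdx), (geomT x.D).dist (β x.hN x.D x.hk (bI x f)) (blkV1 x.hN x.D f) ≤ 1)
    (H12 : MemberY θ.d₆ θ.ℓ₆ θ.hd' θ.hL' θ.b₀ θ.b₁ Mstar → Prop)
    (hblk12 : ∀ x : MemberY θ.d₆ θ.ℓ₆ θ.hd' θ.hL' θ.b₀ θ.b₁ Mstar, (𝔬12 x).blk = blkBK x.toKIdx (bI x)) (hblkZ12 : ∀ x : MemberY θ.d₆ θ.ℓ₆ θ.hd' θ.hL' θ.b₀ θ.b₁ Mstar, (𝔬12 x).blkZ = blkHK x.toKIdx)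
    (hQsco12 : ∀ (x : MemberY θ.d₆ θ.ℓ₆ θ.hd' θ.hL' θ.b₀ θ.b₁ Mstar) (U : (bg9YR (Matrix (Fin N) (Fin N) ℂ) (specialUnitaryUnits (Fin N)) R₁ R₂ x).Cfg),
      (𝔬12 x).Qstar U = QscoKHq x.toKIdx (trBasis N) (bg9YR (Matrix (Fin N) (Fin N) ℂ) (specialUnitaryUnits (Fin N)) R₁ R₂ x) (fun U => U) (qsKnitOfRecord N θ x.toKIdx) U)
    {M12 a12 : ℝ} (hM12 : 0 < M12) {δQs ε : ℝ} (hδQs : 0 ≤ δQs) (hε : 0 < ε)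
    (hM12L : Real.log (((θ.ℓ₆ + 1 : ℕ) : ℝ)) ≤ ε * (2 * ((θ.ℓ₆ : ℝ) + 1) ^ 2 - 1) * M12)
    {c₀ : ℝ} (hc : c₀ ≤ 10)
    (hRP : ∀ (x : MemberY θ.d₆ θ.ℓ₆ θ.hd' θ.hL' θ.b₀ θ.b₁ Mstar) (α₀ : ℝ) (U : (bg9YR (Matrix (Fin N) (Fin N) ℂ) (specialUnitaryUnits (Fin N)) R₁ R₂ x).Cfg),
      (bg9YR (Matrix (Fin N) (Fin N) ℂ) (specialUnitaryUnits (Fin N)) R₁ R₂ x).Reg335 c α₀ U → (bg9KP (Matrix (Fin N) (Fin N) ℂ) (specialUnitaryUnits (Fin N)) x.toKIdx).Reg335 c₀ α₀ U)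
    {α₀' : ℝ} (hα' : 0 < α₀') (hαQ : α₀' ≤ alphaQ (θ.d₆ + 1) (θ.ℓ₆ + 1))
    (hKpl : ∀ (x : MemberY θ.d₆ θ.ℓ₆ θ.hd' θ.hL' θ.b₀ θ.b₁ Mstar) (a : ℝ), 0 ≤ a → a ≤ a12 → Kpl x.toKIdx a * (kGeo x.toKIdx).L ^ 4 < α₀') :
    ∀ x : MemberY θ.d₆ θ.ℓ₆ θ.hd' θ.hL' θ.b₀ θ.b₁ Mstar, M12 ≤ (geo9Y x).M → ∀ α₀ : ℝ, 0 < α₀ → (geo9Y x).M * α₀ ≤ a12 →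
      ∀ U : (bg9YR (Matrix (Fin N) (Fin N) ℂ) (specialUnitaryUnits (Fin N)) R₁ R₂ x).Cfg, (bg9YR (Matrix (Fin N) (Fin N) ℂ) (specialUnitaryUnits (Fin N)) R₁ R₂ x).Reg335 c α₀ U →
        BlockBd (g := toB6 (geo9Y x) 1 (H12 x)) (𝔬12 x).blkZ (𝔬12 x).blk ((𝔬12 x).Qstar U)
          (fun (y y' : (geo9Y x).Site) => ((N : ℝ) ^ 4 * (1 + kCol (θ.d₆ + 1) (θ.ℓ₆ + 1) * α₀' * (2 * ((θ.d₆ : ℝ) + 1))) * (((θ.ℓ₆ + 1 : ℕ) : ℝ)) *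
              Real.exp ((δQs + ε) * ((θ.ℓ₆ : ℝ) + 4))) * ((geo9Y x).len y)⁻¹ *
            (Real.sqrt (((((θ.ℓ₆ + 1 : ℕ) : ℝ) ^ (θ.d₆ + 1)) ^ lvl x.hN x.D x.hk y')⁻¹) * (geo9Y x).len y') * Real.exp (-(δQs * (geo9Y x).dist y y'))) := by
  intro x hM α₀ hα ha U hU
  letI : Fintype (geo9K x.toKIdx).Site := (inferInstance : Fintype (geo9Y x).Site)
  have hMx : 0 ≤ (geo9Y x).M := hM12.le.trans hM
  have hMα : 0 ≤ (kGeo x.toKIdx).M * α₀ := mul_nonneg hMx hα.le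
  have hKx : Kpl x.toKIdx ((kGeo x.toKIdx).M * α₀) * (kGeo x.toKIdx).L ^ 4 < α₀' := hKpl x _ hMα ha
  have hthr := transfer_of_floor θ Mstar hε hM12L x hM
  have h := blockBd_QscoKHq_adjTrY_QknitY_of_reg335P x.toKIdx (hβ1 x) specialUnitaryUnits_le_unitaryUnits
    (bg9YR (Matrix (Fin N) (Fin N) ℂ) (specialUnitaryUnits (Fin N)) R₁ R₂ x) (fun U => U) (qsKnitOfRecord N θ x.toKIdx) (U₁ := U)
    (show qsKnitOfRecord N θ x.toKIdx U = adjTrY (QknitY x.toKIdx U) from rfl) hc hMα (hRP x α₀ U hU) hα' hαQ hKx hδQs hε hthr (R₀ := (1 : ℝ)) (H₀ := H12 x)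
  rw [hblk12 x, hblkZ12 x, hQsco12 x U]
  exact h

/-- ★★★ **KD's BINDER `hqL2K` AT THE KNIT PAIR** (the `Q` letter, pinned by `hQco12` to def-Y's `QcoKHq … (qKnitOfRecord N θ x.toKIdx)`): same data as `hqsL2K_knit_of_laws`, same
constant `BQL := N⁴(1 + 2(d+1)K_col α₀′)·L·e^{(δQs+ε)(ℓ+4)}` and rate `δQs` — `qsKnitOfRecord = adjTrY ∘ qKnitOfRecord` is the trace adjoint, so the `Q⋆` letter transposes.
[cite: Balaban1985BackgroundPropagators, Thm 3.13 p.426 (the letter Q), (3.13) p.393 («Q* the adjoint of Q»), (3.46) p.398 + remark after (3.47), (3.115) p.418, (3.35) p.396; Balaban1984PropagatorsII, Lemma 2.1 (2.60) p.234] -/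
theorem hqL2K_knit_of_laws
    {W12 : MemberY θ.d₆ θ.ℓ₆ θ.hd' θ.hL' θ.b₀ θ.b₁ Mstar → Type} [∀ x, Fintype (W12 x)]
    (𝔬12 : ∀ x : MemberY θ.d₆ θ.ℓ₆ θ.hd' θ.hL' θ.b₀ θ.b₁ Mstar, Ops (geo9Y x) (bg9YR (Matrix (Fin N) (Fin N) ℂ) (specialUnitaryUnits (Fin N)) R₁ R₂ x) (XBK (TrIdx N) x.toKIdx) (XBK (TrIdx N) x.toKIdx) (XHK (TrIdx N) x.toKIdx) (W12 x))
    (bI : ∀ x : MemberY θ.d₆ θ.ℓ₆ θ.hd' θ.hL' θ.b₀ θ.b₁ Mstar, FBondY x.toKIdx → IBondY x.toKIdx)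
    (hβ1 : ∀ (x : MemberY θ.d₆ θ.ℓ₆ θ.hd' θ.hL' θ.b₀ θ.b₁ Mstar) (f : FBondY x.toKIdx), (geomT x.D).dist (β x.hN x.D x.hk (bI x f)) (blkV1 x.hN x.D f) ≤ 1)
    (H12 : MemberY θ.d₆ θ.ℓ₆ θ.hd' θ.hL' θ.b₀ θ.b₁ Mstar → Prop)
    (hblk12 : ∀ x : MemberY θ.d₆ θ.ℓ₆ θ.hd' θ.hL' θ.b₀ θ.b₁ Mstar, (𝔬12 x).blk = blkBK x.toKIdx (bI x)) (hblkZ12 : ∀ x : MemberY θ.d₆ θ.ℓ₆ θ.hd' θ.hL' θ.b₀ θ.b₁ Mstar, (𝔬12 x).blkZ = blkHK x.toKIdx)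
    (hQco12 : ∀ (x : MemberY θ.d₆ θ.ℓ₆ θ.hd' θ.hL' θ.b₀ θ.b₁ Mstar) (U : (bg9YR (Matrix (Fin N) (Fin N) ℂ) (specialUnitaryUnits (Fin N)) R₁ R₂ x).Cfg),
      (𝔬12 x).Q U = QcoKHq x.toKIdx (trBasis N) (bg9YR (Matrix (Fin N) (Fin N) ℂ) (specialUnitaryUnits (Fin N)) R₁ R₂ x) (fun U => U) (qKnitOfRecord N θ x.toKIdx) U)
    {M12 a12 : ℝ} (hM12 : 0 < M12) {δQs ε : ℝ} (hδQs : 0 ≤ δQs) (hε : 0 < ε)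
    (hM12L : Real.log (((θ.ℓ₆ + 1 : ℕ) : ℝ)) ≤ ε * (2 * ((θ.ℓ₆ : ℝ) + 1) ^ 2 - 1) * M12)
    {c₀ : ℝ} (hc : c₀ ≤ 10)
    (hRP : ∀ (x : MemberY θ.d₆ θ.ℓ₆ θ.hd' θ.hL' θ.b₀ θ.b₁ Mstar) (α₀ : ℝ) (U : (bg9YR (Matrix (Fin N) (Fin N) ℂ) (specialUnitaryUnits (Fin N)) R₁ R₂ x).Cfg),
      (bg9YR (Matrix (Fin N) (Fin N) ℂ) (specialUnitaryUnits (Fin N)) R₁ R₂ x).Reg335 c α₀ U → (bg9KP (Matrix (Fin N) (Fin N) ℂ) (specialUnitaryUnits (Fin N)) x.toKIdx).Reg335 c₀ α₀ U)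
    {α₀' : ℝ} (hα' : 0 < α₀') (hαQ : α₀' ≤ alphaQ (θ.d₆ + 1) (θ.ℓ₆ + 1))
    (hKpl : ∀ (x : MemberY θ.d₆ θ.ℓ₆ θ.hd' θ.hL' θ.b₀ θ.b₁ Mstar) (a : ℝ), 0 ≤ a → a ≤ a12 → Kpl x.toKIdx a * (kGeo x.toKIdx).L ^ 4 < α₀') :
    ∀ x : MemberY θ.d₆ θ.ℓ₆ θ.hd' θ.hL' θ.b₀ θ.b₁ Mstar, M12 ≤ (geo9Y x).M → ∀ α₀ : ℝ, 0 < α₀ → (geo9Y x).M * α₀ ≤ a12 →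
      ∀ U : (bg9YR (Matrix (Fin N) (Fin N) ℂ) (specialUnitaryUnits (Fin N)) R₁ R₂ x).Cfg, (bg9YR (Matrix (Fin N) (Fin N) ℂ) (specialUnitaryUnits (Fin N)) R₁ R₂ x).Reg335 c α₀ U →
        BlockBd (g := toB6 (geo9Y x) 1 (H12 x)) (𝔬12 x).blk (𝔬12 x).blkZ ((𝔬12 x).Q U)
          (fun (y y' : (geo9Y x).Site) => ((N : ℝ) ^ 4 * (1 + kCol (θ.d₆ + 1) (θ.ℓ₆ + 1) * α₀' * (2 * ((θ.d₆ : ℝ) + 1))) * (((θ.ℓ₆ + 1 : ℕ) : ℝ)) *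
              Real.exp ((δQs + ε) * ((θ.ℓ₆ : ℝ) + 4))) *
            (Real.sqrt (((((θ.ℓ₆ + 1 : ℕ) : ℝ) ^ (θ.d₆ + 1)) ^ lvl x.hN x.D x.hk y)⁻¹) * (geo9Y x).len y * ((geo9Y x).len y')⁻¹) *
              Real.exp (-(δQs * (geo9Y x).dist y y'))) := by
  intro x hM α₀ hα ha U hU
  letI : Fintype (geo9K x.toKIdx).Site := (inferInstance : Fintype (geo9Y x).Site)
  have hMx : 0 ≤ (geo9Y x).M := hM12.le.trans hM
  have hMα : 0 ≤ (kGeo x.toKIdx).M * α₀ := mul_nonneg hMx hα.le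
  have hKx : Kpl x.toKIdx ((kGeo x.toKIdx).M * α₀) * (kGeo x.toKIdx).L ^ 4 < α₀' := hKpl x _ hMα ha
  have hthr := transfer_of_floor θ Mstar hε hM12L x hM
  have h := blockBd_QcoKHq_QknitY_of_reg335P x.toKIdx (hβ1 x) specialUnitaryUnits_le_unitaryUnits
    (bg9YR (Matrix (Fin N) (Fin N) ℂ) (specialUnitaryUnits (Fin N)) R₁ R₂ x) (fun U => U) (qKnitOfRecord N θ x.toKIdx) (qsKnitOfRecord N θ x.toKIdx) (U₁ := U)
    rfl (show qsKnitOfRecord N θ x.toKIdx U = adjTrY (QknitY x.toKIdx U) from rfl) hc hMα (hRP x α₀ U hU) hα' hαQ hKx hδQs hε hthr (R₀ := (1 : ℝ)) (H₀ := H12 x)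
  rw [hblk12 x, hblkZ12 x, hQco12 x U]
  exact h

end KnitBinder

end Summit.QuantumFields.YangMills.BalabanUVNodes.N06Thm312313ParLawsQL2Knit

end
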